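import Summits.BirchSwinnertonDyer.Rank1Residual.Additive.RamifiedSevenGenusKatoExpReadingValues
import Literature.NumberTheory.EllipticCurves.ZpExtensionArtinExponent
import Literature.NumberTheory.ComplexMultiplication.EllipticUnits.KatoLayerArtinCompatibility
import Literature.FieldTheory.AlgClosed.PadicAlgClEquivComplex
import HarnessLib

set_option autoImplicit false

/-!
# `𝒞₇` genus road (crux `EllipticUnitValueSevenOfGZK`, K7r), row K2C-9 (C6a): THE CONSTRUCTOR `KatoExpDatum.ofLaws` —
# the re-typed dual-exponential value datum of a pinned frame BUILT from its three load-bearing inputs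
# {(e2) CM-functoriality of `exp*` in `𝔏`-form, (eZ) the ★-value law, (psiK) integrality of `ψ` on twists};
# every other field is a TERM or a THEOREM of this row — plus the orientation fix (o-fix) and the existence of `ι₇`

Cell bsd-cm, seat bsd-cm-prr-ty1 g35 (literature-prover), row K2C-9 (C6a) (pen D1009 (6), D1019 (A), D1023 (C), D1026,
D1028; director (739)(2)); file (F-C) of this seat's CHECK.  Parts: (F-B) `Literature/…/ZpExtensionArtinExponent.lean`
((art′): `ZpExtension.artinExponent`, `heckeIdealValue_eq_pow_of_isCoprime`), (F-A1/F-A2) `RamifiedSevenGenusKatoExpReading{,Values}`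
(`valOf` with (e1′), (e1), (eV), and (e2) from `ExpStarCMShape`).

## What `ofLaws` takes and what it builds (the INHABITATION LEDGER of `KatoExpDatum hγ Φ`, p800949 l.130–188)

ARGUMENTS (the residual, NAMED inputs — nothing else is assumed):
* `ι₇ : ℚ_[7] →+* ℂ` — a parameter (one exists: `nonempty_padicRingHom_complex`, Steinitz).
* (e2) `h2 : Φ.ExpStarCMShape` — Kato 15.14 «`O_K` acts through `K`» for the abstract datum `Φ.𝔏` on the torsion layers,
  `𝔏_{U′}(φ_* c) = (1 ⊗ₜ algebraMap Φ.Kcm (AlgebraicClosure Φ.Kcm) Φ.sqrtNegSeven) * 𝔏_{U′}(c)` (road-D definition row;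
  PRE-APPROVED hypothesis, D1019/D1026 (3)); orientation: (o-fix) below.
* (eZ) `e α₀ α₁ hα n₀ hZ` — the ★-value constants and the value law of `res zOne` at primitive characters, the FIELD letter of
  `val_zStar` with `val := Φ.valOf ι₇`, `zStar := I.resOver Φ.IK hγ Φ.isTopGenerator_γK Φ.zOne` substituted (Kato Thm. 12.5 (1);
  crux content = the rational comparison in disguise; PRE-APPROVED hypothesis, D1009 (6)/D1026 (6)).
* (psiK) `b₀ b₁ hψ` — integer coordinates of `2ψ(𝔟)` on admissible twists, the FIELD letter of `psi_eq` (a THEOREM for the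
  intended Deuring `ψ` with clause (vi), tree `Deuring_exists_heckeCharacter_of_maximalCM_withGenerators_holds`; NOT derivable
  from the frame's three `ψ`-pins alone — D1026 (4); hence an argument at the abstract frame).
BUILT (terms + theorems of this row): `ι₇ := ι₇`; `val := Φ.valOf ι₇` (F-A1); (e1) `val_T := valOf_T_smul`; (e1′)
`val_C := valOf_C_smul`; (e2) `val_piK := valOf_piK_of_expStarCM h2`; (eV) `val_euK := valOf_euK` (F-A2); `uStar := 1`,
`zStar := res zOne`, `uStar_smul_zStar := one_smul`; (art′) `artExp := ZpExtension.artinExponent Φ.towerK` and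
`art := heckeIdealValue_eq_pow_of_isCoprime` (F-B) with the two side conditions of an admissible twist — `𝔟 ≠ ⊥`
(`ne_bot_of_isCoprime_katoModulus`) and `IsCoprime 𝔟 (7)` (from `IsTwist.isCoprime_katoModulus_one`, `katoModulus 7 𝔣 1 = (7)·𝔣`),
tree `KatoLayerArtinCompatibility`.  NET: `∃ D : KatoExpDatum hγ Φ` (the datum conjunct of zp v17's stub 2) REDUCES, for every
pinned frame and every `ι₇`, to {(e2), (eZ), (psiK)}; 9 of the 15 fields are terms/theorems.

## Contents
§1 side conditions of admissible twists; `nonempty_padicRingHom_complex`.  §2 ★ `KatoExpDatum.ofLaws` + the `rfl` projections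
`ofLaws_ι₇/val/uStar/zStar/e/α₀/α₁/n₀/bCoef₀/bCoef₁/artExp`, `ofLaws_sigma`; `katoExpCompatShape_of_laws`.  §3 (o-fix): `negSqrt`
(flip `sqrtNegSeven`; every other field kept), `Iff.rfl`-invariance of `ResidueIsGenusUnitClassShape`/`IntegralComparisonShape`,
`eq_or_eq_neg_sqrtNegSeven` (`μ² = −7 ⇒ μ = ±√−7`), and `expStarCMShape_or_negSqrt` (an `𝔏`-law with ANY `μ`, `μ² = −7`, is
`ExpStarCMShape` of `Φ` or of `Φ.negSqrt`) — so the K2C-11 constructor orients by choosing the frame.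

HONEST LABEL: a constructor from named hypotheses, definitions with bodies, kernel lemmas; (e2)/(eZ) are NOT proved (road D /
crux content), (psiK) is an argument at the abstract frame; no stub is closed; stmt-BirchSwinnertonDyer-19945 OPEN (4 sorries,
zp v17); K2ᶜ-inhabitation NOT done; `X12.CMRamifiedSeven` NOT proved; no summit statement is proved by this seat; BSD is claimed
for no curve.

References: K. Kato, Astérisque 295 (2004) Prop. 15.9 / (15.9.1) (pp. 258–259), (15.12.2) (p. 263), 15.14 (p. 264), (15.16.1)
(p. 265), Thm. 12.5 (1) (p. 221), §15.6 (p. 254) [Kato2004Asterisque]; S. Bloch, K. Kato (1990) Def. 3.10 [BlochKato1990];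
L. C. Washington (1997) §13.1, Prop. 13.2 [Washington1997]; J. Neukirch, A. Schmidt, K. Wingberg (2008) XI §1–§2
[NeukirchSchmidtWingberg2008]; E. Steinitz (1910) / tree `PadicAlgClEquivComplex`; tree (C6-R) p800949, F-B, F-A1/F-A2,
`KatoLayerArtinCompatibility`.
-/

noncomputable section

open scoped NumberField TensorProduct
open Field IsDedekindDomain NumberField
open Literature.NumberTheory.GaloisRepresentations
open Literature.NumberTheory.EllipticCurves
open Literature.NumberTheory.EllipticCurves.Rank1Residual
open Literature.NumberTheory.EllipticCurves.IwasawaAlgebra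
open Literature.NumberTheory.EllipticCurves.Kato2004
open Literature.NumberTheory.ComplexMultiplication.EllipticUnits
open Summit.BirchSwinnertonDyer.Rank1Residual

namespace Summit.BirchSwinnertonDyer.Rank1Residual.Additive.GenusSeven

/-! ## §1 Side conditions of admissible twists; a complex reading of `ℚ₇` exists -/

section Twist

variable {L : Type} [Field L] [NumberField L]

/-- An admissible twist (`IsTwist 7 𝔣 𝔟`: prime to `6·7·𝔣`, `≠ O_K`) is a NON-ZERO ideal (tree `ne_bot_of_isCoprime_katoModulus`
with `IsTwist.isCoprime_katoModulus_one`). [cite: Kato2004Asterisque, §15.6 (p. 254)] -/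
theorem ne_bot_of_isTwist {𝔣 𝔟 : Ideal (𝓞 L)} (h : IsTwist 7 𝔣 𝔟) : 𝔟 ≠ ⊥ :=
  haveI : Fact (Nat.Prime 7) := ⟨by norm_num⟩
  ne_bot_of_isCoprime_katoModulus 7 𝔣 h.isCoprime_katoModulus_one

/-- An admissible twist is prime to `(7)` (`katoModulus 7 𝔣 1 = (7)·𝔣`, tree `IsTwist.isCoprime_katoModulus_one`).
[cite: Kato2004Asterisque, §15.6 (p. 254)] -/
theorem isCoprime_span_seven_of_isTwist {𝔣 𝔟 : Ideal (𝓞 L)} (h : IsTwist 7 𝔣 𝔟) :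
    IsCoprime 𝔟 (Ideal.span {((7 : ℕ) : 𝓞 L)}) := by
  have h1 : IsCoprime 𝔟 (katoModulus 7 𝔣 1) := h.isCoprime_katoModulus_one
  rw [katoModulus_one] at h1
  exact h1.of_mul_right_left

end Twist

/-- **A ring embedding `ℚ₇ → ℂ` exists** (`ℚ₇ ⊂ ℚ̄₇ ≃ ℂ`, Steinitz; tree `PadicAlgCl.nonempty_ringEquiv_complex`): the parameter
`ι₇` of `KatoExpDatum.ofLaws` can always be supplied. [folklore] -/
theorem nonempty_padicRingHom_complex : Nonempty (ℚ_[7] →+* ℂ) :=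
  haveI : Fact (Nat.Prime 7) := ⟨by norm_num⟩
  let ⟨e⟩ := PadicAlgCl.nonempty_ringEquiv_complex 7
  ⟨e.toRingHom.comp (algebraMap ℚ_[7] (PadicAlgCl 7))⟩

/-! ## §2 The constructor -/

section Frame

variable {W : WeierstrassCurve ℚ} [W.IsElliptic] [W.IsGloballyMinimal] [Fact (Nat.Prime 7)]
  [ContinuousSMul ℤ_[7] (W.tateModule 7)] {K : ZpExtension ℚ 7} {hK : K.IsCyclotomic}
  {γ : Field.absoluteGaloisGroup ℚ} {I : IwasawaH1Data W 7 K γ}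
  {F : GenusFrame} {θu : ∀ n : ℕ, globalUnitsOf (F.layer n)} {d : GenusDatum F θu}

namespace KatoExpDatum

/-- ★ **`KatoExpDatum.ofLaws` — THE INHABITATION CONSTRUCTOR of the re-typed dual-exponential value datum** (module docstring
«What `ofLaws` takes and what it builds»): from a complex reading `ι₇` of `ℚ₇`, the (e2) `𝔏`-law `ExpStarCMShape`, the (eZ)
constants and ★-value law at `res zOne` for the reading `valOf`, and the (psiK) integer coordinates of `2ψ` on twists, the datum
with `val := valOf Φ ι₇` ((e1), (e1′), (eV) THEOREMS of F-A1/F-A2), `uStar := 1`, `zStar := res zOne`, and (art′)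
`artExp := artinExponent` with Artin reciprocity level-wise a THEOREM (F-B).  A definition; the three laws it takes are its
only hypotheses. [cite: Kato2004Asterisque, Prop. 15.9 (15.9.1) (pp. 258–259), Thm. 12.5 (1) (p. 221), (15.12.2) (p. 263), 15.14 (p. 264), (15.16.1) (p. 265)]
[cite: BlochKato1990, Def. 3.10 (p. 359)] [cite: Washington1997, §13.1 and Prop. 13.2] -/
def ofLaws (hγ : K.IsTopGenerator γ) (Φ : PinnedKatoGenusFrame W K hK I d) (ι₇ : ℚ_[7] →+* ℂ)
    (h2 : Φ.ExpStarCMShape)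
    (e : ℕ) (α₀ α₁ : ℤ) (hα : α₀ ≠ 0 ∨ α₁ ≠ 0) (n₀ : ℕ)
    (hZ : ∀ (n : ℕ), n₀ ≤ n → ∀ (χ : absoluteGaloisGroup Φ.Kcm →ₜ* ℂˣ),
      (∀ σ ∈ Φ.towerK.layerSubgroup (n + 1), χ σ = 1) →
      IsPrimitiveRoot (((χ Φ.γK : ℂˣ)) : ℂ) (7 ^ (n + 1)) →
      ∀ Lf : ℂ → ℂ, CM.IsDepletedHeckeL Φ.ψ χ (7 * (7 * F.d)) Lf →
        (7 : ℂ) ^ e * Φ.valOf ι₇ χ (I.resOver Φ.IK hγ Φ.isTopGenerator_γK Φ.zOne) =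
          ((α₀ : ℂ) + (α₁ : ℂ) * Φ.ιC (algebraMap Φ.Kcm (AlgebraicClosure Φ.Kcm) Φ.sqrtNegSeven)) * Φ.Ω⁻¹ * Lf 1)
    (b₀ b₁ : Ideal (𝓞 Φ.Kcm) → ℤ)
    (hψ : ∀ (𝔟 : Ideal (𝓞 Φ.Kcm)), IsTwist 7 Φ.𝔣 𝔟 →
      2 * CM.heckeCharIdealValue Φ.ψ 𝔟 =
        (b₀ 𝔟 : ℂ) + (b₁ 𝔟 : ℂ) * Φ.ιC (algebraMap Φ.Kcm (AlgebraicClosure Φ.Kcm) Φ.sqrtNegSeven)) :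
    KatoExpDatum hγ Φ where
  ι₇ := ι₇
  val := Φ.valOf ι₇
  val_T := fun χ hχ x => Φ.valOf_T_smul ι₇ χ hχ x
  val_C := fun χ _ c x => Φ.valOf_C_smul ι₇ χ c x
  val_piK := fun χ _ x => Φ.valOf_piK_of_expStarCM h2 ι₇ χ x
  val_euK := fun 𝔟 h𝔟 n χ hχ Lf hLf => Φ.valOf_euK ι₇ 𝔟 h𝔟 n χ hχ Lf hLf
  uStar := 1
  zStar := I.resOver Φ.IK hγ Φ.isTopGenerator_γK Φ.zOne
  uStar_smul_zStar := by rw [Units.val_one, one_smul]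
  e := e
  α₀ := α₀
  α₁ := α₁
  α_ne_zero := hα
  n₀ := n₀
  val_zStar := hZ
  bCoef₀ := b₀
  bCoef₁ := b₁
  psi_eq := hψ
  artExp := ZpExtension.artinExponent Φ.towerK
  art := fun 𝔟 h𝔟 n m hm χ hχ =>
    ZpExtension.heckeIdealValue_eq_pow_of_isCoprime Φ.towerK Φ.isTopGenerator_γK χ hχ (ne_bot_of_isTwist h𝔟)
      (isCoprime_span_seven_of_isTwist h𝔟) hm

variable {hγ : K.IsTopGenerator γ} {Φ : PinnedKatoGenusFrame W K hK I d} {ι₇ : ℚ_[7] →+* ℂ}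
  {h2 : Φ.ExpStarCMShape} {e : ℕ} {α₀ α₁ : ℤ} {hα : α₀ ≠ 0 ∨ α₁ ≠ 0} {n₀ : ℕ}
  {hZ : ∀ (n : ℕ), n₀ ≤ n → ∀ (χ : absoluteGaloisGroup Φ.Kcm →ₜ* ℂˣ),
      (∀ σ ∈ Φ.towerK.layerSubgroup (n + 1), χ σ = 1) →
      IsPrimitiveRoot (((χ Φ.γK : ℂˣ)) : ℂ) (7 ^ (n + 1)) →
      ∀ Lf : ℂ → ℂ, CM.IsDepletedHeckeL Φ.ψ χ (7 * (7 * F.d)) Lf →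
        (7 : ℂ) ^ e * Φ.valOf ι₇ χ (I.resOver Φ.IK hγ Φ.isTopGenerator_γK Φ.zOne) =
          ((α₀ : ℂ) + (α₁ : ℂ) * Φ.ιC (algebraMap Φ.Kcm (AlgebraicClosure Φ.Kcm) Φ.sqrtNegSeven)) * Φ.Ω⁻¹ * Lf 1}
  {b₀ b₁ : Ideal (𝓞 Φ.Kcm) → ℤ}
  {hψ : ∀ (𝔟 : Ideal (𝓞 Φ.Kcm)), IsTwist 7 Φ.𝔣 𝔟 →
      2 * CM.heckeCharIdealValue Φ.ψ 𝔟 =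
        (b₀ 𝔟 : ℂ) + (b₁ 𝔟 : ℂ) * Φ.ιC (algebraMap Φ.Kcm (AlgebraicClosure Φ.Kcm) Φ.sqrtNegSeven)}

/-- Projection: `ι₇`. [cite: Kato2004Asterisque, Thm. 12.5 (1) (p. 221)] -/
@[simp] theorem ofLaws_ι₇ : (ofLaws hγ Φ ι₇ h2 e α₀ α₁ hα n₀ hZ b₀ b₁ hψ).ι₇ = ι₇ := rfl

/-- Projection: `val = valOf Φ ι₇`. [cite: Kato2004Asterisque, Prop. 15.9 (p. 258)] -/
@[simp] theorem ofLaws_val : (ofLaws hγ Φ ι₇ h2 e α₀ α₁ hα n₀ hZ b₀ b₁ hψ).val = Φ.valOf ι₇ := rfl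

/-- Projection: `uStar = 1`. [cite: Kato2004Asterisque, Thm. 12.5 (1) (p. 221)] -/
@[simp] theorem ofLaws_uStar : (ofLaws hγ Φ ι₇ h2 e α₀ α₁ hα n₀ hZ b₀ b₁ hψ).uStar = 1 := rfl

/-- Projection: `zStar = res zOne`. [cite: Kato2004Asterisque, Thm. 12.5 (1) (p. 221) and 15.14 (p. 264)] -/
@[simp] theorem ofLaws_zStar :
    (ofLaws hγ Φ ι₇ h2 e α₀ α₁ hα n₀ hZ b₀ b₁ hψ).zStar = I.resOver Φ.IK hγ Φ.isTopGenerator_γK Φ.zOne := rfl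

/-- Projection: `e`. [cite: Kato2004Asterisque, (15.16.1) (p. 265)] -/
@[simp] theorem ofLaws_e : (ofLaws hγ Φ ι₇ h2 e α₀ α₁ hα n₀ hZ b₀ b₁ hψ).e = e := rfl

/-- Projection: `α₀`. [cite: Kato2004Asterisque, (15.16.1) (p. 265)] -/
@[simp] theorem ofLaws_α₀ : (ofLaws hγ Φ ι₇ h2 e α₀ α₁ hα n₀ hZ b₀ b₁ hψ).α₀ = α₀ := rfl

/-- Projection: `α₁`. [cite: Kato2004Asterisque, (15.16.1) (p. 265)] -/
@[simp] theorem ofLaws_α₁ : (ofLaws hγ Φ ι₇ h2 e α₀ α₁ hα n₀ hZ b₀ b₁ hψ).α₁ = α₁ := rfl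

/-- Projection: `n₀`. [cite: Kato2004Asterisque, Thm. 12.5 (1) (p. 221)] -/
@[simp] theorem ofLaws_n₀ : (ofLaws hγ Φ ι₇ h2 e α₀ α₁ hα n₀ hZ b₀ b₁ hψ).n₀ = n₀ := rfl

/-- Projection: `bCoef₀`. [cite: Kato2004Asterisque, §15.7 (p. 256)] -/
@[simp] theorem ofLaws_bCoef₀ : (ofLaws hγ Φ ι₇ h2 e α₀ α₁ hα n₀ hZ b₀ b₁ hψ).bCoef₀ = b₀ := rfl

/-- Projection: `bCoef₁`. [cite: Kato2004Asterisque, §15.7 (p. 256)] -/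
@[simp] theorem ofLaws_bCoef₁ : (ofLaws hγ Φ ι₇ h2 e α₀ α₁ hα n₀ hZ b₀ b₁ hψ).bCoef₁ = b₁ := rfl

/-- Projection: `artExp = artinExponent` of the cyclotomic `ℤ₇`-tower of `Kcm`. [cite: Kato2004Asterisque, (15.12.2) (p. 263)] -/
@[simp] theorem ofLaws_artExp :
    (ofLaws hγ Φ ι₇ h2 e α₀ α₁ hα n₀ hZ b₀ b₁ hψ).artExp = ZpExtension.artinExponent Φ.towerK := rfl

/-- The derived `σ_𝔟 = (1+X)^{κ(𝔟)}` of the constructed datum is the binomial series of the ARTIN EXPONENT.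
[cite: Kato2004Asterisque, (15.12.2) (p. 263)] [cite: Washington1997, §13.2] -/
theorem ofLaws_sigma (𝔟 : Ideal (𝓞 Φ.Kcm)) :
    (ofLaws hγ Φ ι₇ h2 e α₀ α₁ hα n₀ hZ b₀ b₁ hψ).sigma 𝔟 =
      PowerSeries.binomialSeries ℤ_[7] (ZpExtension.artinExponent Φ.towerK 𝔟) := rfl

/-- The normalised norm `N(α)` of the constructed datum. [cite: Kato2004Asterisque, (15.16.1) (p. 265)] -/
theorem ofLaws_normA : (ofLaws hγ Φ ι₇ h2 e α₀ α₁ hα n₀ hZ b₀ b₁ hψ).normA = (α₀ ^ 2 + 7 * α₁ ^ 2).toNat := rfl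

end KatoExpDatum

/-- ★ **`KatoExpCompatShape hγ Φ` FROM THE THREE LAWS** (corollary of the constructor): the (r3) binder of block (R) — the
pinned frame ADMITS a re-typed dual-exponential value datum — holds as soon as (e2) in `𝔏`-form, the (eZ) ★-value law for the
reading `valOf`, and (psiK) are supplied. [cite: Kato2004Asterisque, Prop. 15.9 (p. 258), Thm. 12.5 (1) (p. 221), 15.14 (p. 264)] -/
theorem katoExpCompatShape_of_laws (hγ : K.IsTopGenerator γ) (Φ : PinnedKatoGenusFrame W K hK I d) (ι₇ : ℚ_[7] →+* ℂ)
    (h2 : Φ.ExpStarCMShape)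
    (e : ℕ) (α₀ α₁ : ℤ) (hα : α₀ ≠ 0 ∨ α₁ ≠ 0) (n₀ : ℕ)
    (hZ : ∀ (n : ℕ), n₀ ≤ n → ∀ (χ : absoluteGaloisGroup Φ.Kcm →ₜ* ℂˣ),
      (∀ σ ∈ Φ.towerK.layerSubgroup (n + 1), χ σ = 1) →
      IsPrimitiveRoot (((χ Φ.γK : ℂˣ)) : ℂ) (7 ^ (n + 1)) →
      ∀ Lf : ℂ → ℂ, CM.IsDepletedHeckeL Φ.ψ χ (7 * (7 * F.d)) Lf →
        (7 : ℂ) ^ e * Φ.valOf ι₇ χ (I.resOver Φ.IK hγ Φ.isTopGenerator_γK Φ.zOne) =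
          ((α₀ : ℂ) + (α₁ : ℂ) * Φ.ιC (algebraMap Φ.Kcm (AlgebraicClosure Φ.Kcm) Φ.sqrtNegSeven)) * Φ.Ω⁻¹ * Lf 1)
    (b₀ b₁ : Ideal (𝓞 Φ.Kcm) → ℤ)
    (hψ : ∀ (𝔟 : Ideal (𝓞 Φ.Kcm)), IsTwist 7 Φ.𝔣 𝔟 →
      2 * CM.heckeCharIdealValue Φ.ψ 𝔟 =
        (b₀ 𝔟 : ℂ) + (b₁ 𝔟 : ℂ) * Φ.ιC (algebraMap Φ.Kcm (AlgebraicClosure Φ.Kcm) Φ.sqrtNegSeven)) :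
    KatoExpCompatShape hγ Φ :=
  ⟨KatoExpDatum.ofLaws hγ Φ ι₇ h2 e α₀ α₁ hα n₀ hZ b₀ b₁ hψ⟩

/-! ## §3 (o-fix): the orientation of `sqrtNegSeven` is the frame constructor's choice -/

namespace PinnedKatoGenusFrame

variable (Φ : PinnedKatoGenusFrame W K hK I d)

/-- **`Φ.negSqrt` — the same pinned frame with the opposite square root of `−7`** (`sqrtNegSeven ↦ −sqrtNegSeven`; every
other field kept).  The field `sqrtNegSeven` is read by nothing in the frame but its square (pen D1019 (A)); it fixes the sign
in (e2)/(eZ)/(psiK) of a datum, so a constructor may re-orient the frame to match the sign delivered by the `exp*` of the CM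
endomorphism `φ`. [cite: Kato2004Asterisque, 15.14 (p. 264) and §15.11 (p. 260, "K = ℚ(√−N)")] -/
def negSqrt : PinnedKatoGenusFrame W K hK I d :=
  { Φ with
    sqrtNegSeven := -Φ.sqrtNegSeven
    sqrtNegSeven_sq := by rw [neg_sq]; exact Φ.sqrtNegSeven_sq }

/-- `Φ.negSqrt.sqrtNegSeven = −Φ.sqrtNegSeven`. [cite: Kato2004Asterisque, §15.11 (p. 260)] -/
@[simp] theorem negSqrt_sqrtNegSeven : Φ.negSqrt.sqrtNegSeven = -Φ.sqrtNegSeven := rfl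

/-- The datum `𝔏` is unchanged by re-orientation. [cite: Kato2004Asterisque, Prop. 15.9 (p. 258)] -/
theorem negSqrt_𝔏 : Φ.negSqrt.𝔏 = Φ.𝔏 := rfl

/-- The CM endomorphism `φ` is unchanged by re-orientation. [cite: Kato2004Asterisque, 15.14 (p. 264)] -/
theorem negSqrt_φ : Φ.negSqrt.φ = Φ.φ := rfl

/-- Crux K2ᶜ's weak shape is INVARIANT under re-orientation (it reads `Kcm`, `𝔣`, `frame` only).
[cite: Kato2004Asterisque, §15.16 (15.16.1) (p. 265)] -/
theorem residueIsGenusUnitClassShape_negSqrt_iff :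
    ResidueIsGenusUnitClassShape Φ.negSqrt.toKatoGenusFrame ↔ ResidueIsGenusUnitClassShape Φ.toKatoGenusFrame :=
  Iff.rfl

/-- The pinned integral comparison is INVARIANT under re-orientation. [cite: Kato2004Asterisque, §15.16 (15.16.1) (p. 265)] -/
theorem integralComparisonShape_negSqrt_iff : IntegralComparisonShape Φ.negSqrt ↔ IntegralComparisonShape Φ :=
  Iff.rfl

/-- In the CM field a square root of `−7` is `±sqrtNegSeven`. [cite: Kato2004Asterisque, §15.11 (p. 260, "K = ℚ(√−N)")] -/
theorem eq_or_eq_neg_sqrtNegSeven {μ : Φ.Kcm} (hμ : μ ^ 2 = -7) : μ = Φ.sqrtNegSeven ∨ μ = -Φ.sqrtNegSeven :=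
  sq_eq_sq_iff_eq_or_eq_neg.mp (by rw [hμ, Φ.sqrtNegSeven_sq])

/-- ★ (o-fix) **An `𝔏`-law of CM-functoriality with ANY square root `μ` of `−7` orients one of the two frames**: if on every
torsion layer `𝔏_{U′}(φ_* c) = (1 ⊗ μ)·𝔏_{U′}(c)` with `μ ∈ Kcm`, `μ² = −7` (the shape [T2] `Kato2004.expStarCoord_endo_eq_mul`
delivers for a defined `exp*`), then `ExpStarCMShape` holds for `Φ` or for `Φ.negSqrt`. [cite: Kato2004Asterisque, 15.14 (p. 264)]
[cite: BlochKato1990, Def. 3.10 and Ex. 3.11] -/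
theorem expStarCMShape_or_negSqrt {μ : Φ.Kcm} (hμ : μ ^ 2 = -7)
    (h : ∀ (m : ℕ) (c : H1 (CM.tateRepK (W.baseChange Φ.Kcm) 7) (CM.torsionLayer (W.baseChange Φ.Kcm) (7 ^ m * (7 * F.d)))),
      Φ.𝔏 (CM.torsionLayer (W.baseChange Φ.Kcm) (7 ^ m * (7 * F.d)))
          (isogenyLayerMapK 7 Φ.φ (CM.torsionLayer (W.baseChange Φ.Kcm) (7 ^ m * (7 * F.d))) c) =
        ((1 : ℚ_[7]) ⊗ₜ[ℤ] algebraMap Φ.Kcm (AlgebraicClosure Φ.Kcm) μ) *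
          Φ.𝔏 (CM.torsionLayer (W.baseChange Φ.Kcm) (7 ^ m * (7 * F.d))) c) :
    Φ.ExpStarCMShape ∨ Φ.negSqrt.ExpStarCMShape := by
  rcases Φ.eq_or_eq_neg_sqrtNegSeven hμ with rfl | rfl
  · exact Or.inl h
  · exact Or.inr h

end PinnedKatoGenusFrame

end Frame

end Summit.BirchSwinnertonDyer.Rank1Residual.Additive.GenusSeven

end
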